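import Literature.NumberTheory.Automorphic.LieGraphIsomorphism
import Literature.NumberTheory.Automorphic.IsomorphismGraphLieGens
import Literature.NumberTheory.Automorphic.AdTrivialTorus
import HarnessLib

/-!
# The graph group: it stabilises the graph Lie algebra, its kernel lies in the torus, and it projects onto both groups
(trunk T-AUTOMORPHIC, G25 AutomorphicL; group-level step of the graph proof of
`chevalley_isomorphism_abstract` / `chevalley_isomorphism`, Springer 9.6.2, Humphreys LAG §33)

Let `(G₁, T₁)`, `(G₂, T₂)` be connected reductive with the same root datum `P` over an algebraically
closed field of characteristic `0`, `y` a regular coweight with simple roots `Δ = simpleRoots P y`,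
`D = graphSubalgebra … y` the graph Lie algebra (`LieGraphSetup…Isomorphism.lean`: the graph of the
Lie-algebra isomorphism `ψ : 𝔤₁ ≅ 𝔤₂`) and
`H = graphGroup h₁ h₂ hT₁ hT₂ Δ ≤ G₁ × G₂ ≤ GL (n₁ ⊕ n₂)` the graph group of
`IsomorphismGraphGroup.lean` (generated by the graph torus `T̃ = {diag(t, f_T t)}` and the diagonal
root homomorphisms `ũ_i(x) = diag(φ_i(u⁺ x), φ'_i(u⁺ x))`, `ṽ_i`, `i ∈ Δ`). This file proves:

* **`H` stabilises `D`** (`graphGroup_le_adStab`): the subgroup `adStab` of the `diag(g₁, g₂)`,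
  `gⱼ ∈ Gⱼ`, with `(Ad g₁ × Ad g₂) D = D` contains `T̃` (`σ_t` of `LieGraphSetup`) and the
  `ũ_i(±x)`, `ṽ_i(±x)` (`Ad (exp N̄) = exp (ad N̄)` on the product algebra, `conj_exp_pair_mem`,
  with `N̄ = x (e¹_i, e²_i) ∈ D`);
* **the kernel lies in the torus** (`mem_torus_of_inrBlock_mem_graphGroup`): if `diag(1, z) ∈ H`
  then `z ∈ T₂` — `Ad z` fixes `p₂(D) = 𝔤₂` pointwise (`D` is a graph, `eq_of_fst_eq`), hence `z`
  commutes with the root `SL₂`'s of `G₂` and `AdTrivialTorus.mem_torus_of_forall_commute_rootSL2`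
  applies; symmetrically `mem_torus_of_inlBlock_mem_graphGroup`;
* **the projections are surjective** (`fstOfGraphGroup_eq`, `sndOfGraphGroup_eq`): the image `F₁` of
  `H` in `G₁` is closed connected (`isZConnected_map_of_le`), its Lie algebra contains `Lie(T₁)` and
  the `e¹_i, f¹_i`, `i ∈ Δ`, hence all root vectors (generation theorem of `RootStrings.lean`), hence
  `Lie(F₁) = Lie(G₁)` and `F₁ = G₁` (`IsZConnected.eq_of_le_of_lieAlgebraGL_eq`); unpacked as
  `exists_blockDiagGL_mem_graphGroup` / `exists_blockDiagGL_mem_graphGroup'`.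

Everything is proved; no named fact is introduced.

## Mathlib / Literature

Searched `adStab`, `fstOfGraphGroup`, `Ad` + `exp` on products, `units_of_val`: the graph group, its
torus, generators and projections `fstOfGraphGroup`/`sndOfGraphGroup` are those of
`IsomorphismGraphGroup.lean` / `IsomorphismGraphLieGens.lean` (reused, not restated); `Ad (exp N)` on
one factor is `ChevalleyGroupAdjoint.exp_mul_mul_exp_neg_eq` (used through `conj_exp_pair_mem`); the
kernel step is `AdTrivialTorus.mem_torus_of_forall_commute_rootSL2`. Nothing here duplicates a Mathlib
or Literature declaration.

## References

* [SpringerLAG1998] T. A. Springer, *Linear Algebraic Groups*, 2nd ed. (1998), 9.6.2, 7.6.4, 4.4.15.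
* J. E. Humphreys, *Linear Algebraic Groups*, GTM 21 (1975), §33.
-/

noncomputable section

open scoped MatrixGroups IsMulCommutative
open Set

attribute [local instance 100] LieRing.ofAssociativeRing

namespace Literature.NumberTheory.Automorphic

namespace LieGraph

variable {k : Type*} [Field k]
variable {n₁ n₂ : Type*} [Fintype n₁] [DecidableEq n₁] [Fintype n₂] [DecidableEq n₂]
variable {ι X Y : Type*} [AddCommGroup X] [AddCommGroup Y]
variable {G₁ T₁ : Subgroup (GL n₁ k)} {G₂ T₂ : Subgroup (GL n₂ k)}
  [IsMulCommutative ↥T₁] [IsMulCommutative ↥T₂]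
variable {P : RootPairing ι ℤ X Y}
variable {eX₁ : Additive ↥(characterLattice T₁) ≃+ X} {eY₁ : Additive ↥(cocharacterLattice T₁) ≃+ Y}
variable {eX₂ : Additive ↥(characterLattice T₂) ≃+ X} {eY₂ : Additive ↥(cocharacterLattice T₂) ≃+ Y}

/-! ### `Ad` of pairs and exponentials of pairs -/

section AdPair

omit [IsMulCommutative ↥T₁] [IsMulCommutative ↥T₂] in
/-- The iterated adjoint of a pair acts componentwise: `(ad (N₁, N₂))^m (A, B) = ((ad N₁)^m A, (ad N₂)^m B)`.
[folklore] -/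
lemma ad_pair_pow_apply (N d : Matrix n₁ n₁ k × Matrix n₂ n₂ k) (m : ℕ) :
    ((LieModule.toEnd k _ (Matrix n₁ n₁ k × Matrix n₂ n₂ k) N) ^ m) d = ((adOp N.1 ^ m) d.1, (adOp N.2 ^ m) d.2) := by
  induction m with
  | zero => simp
  | succ m ih =>
    rw [pow_succ', Module.End.mul_apply, ih, LieModule.toEnd_apply_apply, bracket_eq, pow_succ', pow_succ',
      Module.End.mul_apply, Module.End.mul_apply, adOp_apply, adOp_apply]

omit [IsMulCommutative ↥T₁] [IsMulCommutative ↥T₂] in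
/-- Iterated brackets stay in a Lie subalgebra. [folklore] -/
lemma toEnd_pow_mem {D : LieSubalgebra k (Matrix n₁ n₁ k × Matrix n₂ n₂ k)} {N d : Matrix n₁ n₁ k × Matrix n₂ n₂ k}
    (hN : N ∈ D) (hd : d ∈ D) (m : ℕ) : ((LieModule.toEnd k _ (Matrix n₁ n₁ k × Matrix n₂ n₂ k) N) ^ m) d ∈ D := by
  induction m with
  | zero => simpa using hd
  | succ m ih => rw [pow_succ', Module.End.mul_apply, LieModule.toEnd_apply_apply]; exact D.lie_mem hN ih

omit [IsMulCommutative ↥T₁] [IsMulCommutative ↥T₂] in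
/-- **`(Ad (exp N₁) × Ad (exp N₂))` preserves every Lie subalgebra containing `(N₁, N₂)`**
(`Nⱼ` nilpotent, characteristic `0`): `Ad (exp N̄) = exp (ad N̄)` componentwise with a common
truncation. [cite: SpringerLAG1998, 4.4.15] -/
theorem conj_exp_pair_mem [CharZero k] {D : LieSubalgebra k (Matrix n₁ n₁ k × Matrix n₂ n₂ k)}
    {N d : Matrix n₁ n₁ k × Matrix n₂ n₂ k} (hN : N ∈ D) (h1 : IsNilpotent N.1) (h2 : IsNilpotent N.2)
    (hd : d ∈ D) :
    ((IsNilpotent.exp N.1 * d.1 * IsNilpotent.exp (-N.1), IsNilpotent.exp N.2 * d.2 * IsNilpotent.exp (-N.2)) :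
      Matrix n₁ n₁ k × Matrix n₂ n₂ k) ∈ D := by
  obtain ⟨K₁, hK₁⟩ := isNilpotent_adOp h1
  obtain ⟨K₂, hK₂⟩ := isNilpotent_adOp h2
  have e₁ : adOp N.1 ^ (K₁ + K₂) = 0 := pow_eq_zero_of_le (Nat.le_add_right _ _) hK₁
  have e₂ : adOp N.2 ^ (K₁ + K₂) = 0 := pow_eq_zero_of_le (Nat.le_add_left _ _) hK₂
  rw [exp_mul_mul_exp_neg_eq h1, exp_mul_mul_exp_neg_eq h2, IsNilpotent.exp_eq_sum e₁, IsNilpotent.exp_eq_sum e₂]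
  simp only [LinearMap.coe_sum, Finset.sum_apply, LinearMap.smul_apply]
  have hsum : ((∑ m ∈ Finset.range (K₁ + K₂), (m.factorial : ℚ)⁻¹ • (adOp N.1 ^ m) d.1,
      ∑ m ∈ Finset.range (K₁ + K₂), (m.factorial : ℚ)⁻¹ • (adOp N.2 ^ m) d.2) : Matrix n₁ n₁ k × Matrix n₂ n₂ k) =
      ∑ m ∈ Finset.range (K₁ + K₂), (m.factorial : ℚ)⁻¹ •
        ((LieModule.toEnd k _ (Matrix n₁ n₁ k × Matrix n₂ n₂ k) N) ^ m) d := by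
    refine Prod.ext ?_ ?_
    · rw [Prod.fst_sum]; simp only [Prod.smul_fst, ad_pair_pow_apply]
    · rw [Prod.snd_sum]; simp only [Prod.smul_snd, ad_pair_pow_apply]
  rw [hsum]
  refine D.toSubmodule.sum_mem fun m _ => ?_
  rw [← Rat.cast_smul_eq_qsmul (R := k)]
  exact D.toSubmodule.smul_mem _ (toEnd_pow_mem hN hd m)

variable (g₁ : GL n₁ k) (g₂ : GL n₂ k)

omit [IsMulCommutative ↥T₁] [IsMulCommutative ↥T₂] in
/-- **`Ad g₁ × Ad g₂`** on `𝔤𝔩_{n₁} × 𝔤𝔩_{n₂}`, a Lie automorphism. [folklore] -/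
def adPair : (Matrix n₁ n₁ k × Matrix n₂ n₂ k) →ₗ⁅k⁆ (Matrix n₁ n₁ k × Matrix n₂ n₂ k) where
  toLinearMap := (adGL g₁).prodMap (adGL g₂)
  map_lie' := by
    intro A B
    change (adGL _).prodMap (adGL _) ⁅A, B⁆ = ⁅(adGL _).prodMap (adGL _) A, (adGL _).prodMap (adGL _) B⁆
    rw [LinearMap.prodMap_apply, LinearMap.prodMap_apply, LinearMap.prodMap_apply, bracket_eq,
      bracket_eq, adGL_apply, adGL_apply, adGL_apply, adGL_apply, adGL_apply, adGL_apply]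
    exact Prod.ext (conj_commutator _ _ _) (conj_commutator _ _ _)

omit [IsMulCommutative ↥T₁] [IsMulCommutative ↥T₂] in
/-- Unfolding of `adPair`. [folklore] -/
lemma adPair_apply (d : Matrix n₁ n₁ k × Matrix n₂ n₂ k) :
    adPair g₁ g₂ d = ((g₁ : Matrix n₁ n₁ k) * d.1 * ((g₁⁻¹ : GL n₁ k) : Matrix n₁ n₁ k),
      (g₂ : Matrix n₂ n₂ k) * d.2 * ((g₂⁻¹ : GL n₂ k) : Matrix n₂ n₂ k)) := by
  change (adGL _).prodMap (adGL _) d = _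
  rw [LinearMap.prodMap_apply, adGL_apply, adGL_apply]

omit [IsMulCommutative ↥T₁] [IsMulCommutative ↥T₂] in
/-- `adPair` is multiplicative. [folklore] -/
lemma adPair_mul (g₁' : GL n₁ k) (g₂' : GL n₂ k) (d : Matrix n₁ n₁ k × Matrix n₂ n₂ k) :
    adPair (g₁ * g₁') (g₂ * g₂') d = adPair g₁ g₂ (adPair g₁' g₂' d) := by
  simp only [adPair_apply, Units.val_mul, mul_inv_rev, Matrix.mul_assoc]

omit [IsMulCommutative ↥T₁] [IsMulCommutative ↥T₂] in
/-- `adPair 1 1 = id`. [folklore] -/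
lemma adPair_one (d : Matrix n₁ n₁ k × Matrix n₂ n₂ k) : adPair (1 : GL n₁ k) (1 : GL n₂ k) d = d := by
  simp [adPair_apply]

end AdPair

/-! ### The stabiliser of `D` in `G₁ × G₂` -/

section Stab

variable [IsAlgClosed k] [CharZero k] [Fintype ι]
variable (hG₁ : IsConnectedReductive G₁) (hT₁ : IsMaximalTorusIn T₁ G₁)
  (hG₂ : IsConnectedReductive G₂) (hT₂ : IsMaximalTorusIn T₂ G₂)
  (h₁ : IsRootDatumOf G₁ T₁ P eX₁ eY₁) (h₂ : IsRootDatumOf G₂ T₂ P eX₂ eY₂)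

/-- **The stabiliser `adStab` of the graph Lie algebra `D`**: the `diag(g₁, g₂)`, `gⱼ ∈ Gⱼ`, with
`(Ad g₁ × Ad g₂) D ⊆ D` and `(Ad g₁⁻¹ × Ad g₂⁻¹) D ⊆ D`. [cite: SpringerLAG1998, 9.6.2] -/
def adStab (y : Y) : Subgroup (GL (n₁ ⊕ n₂) k) where
  carrier := {g | ∃ g₁ : GL n₁ k, ∃ g₂ : GL n₂ k, g₁ ∈ G₁ ∧ g₂ ∈ G₂ ∧ blockDiagGL (g₁, g₂) = g ∧
    (∀ d ∈ graphSubalgebra hT₁ hT₂ h₁ h₂ y, adPair g₁ g₂ d ∈ graphSubalgebra hT₁ hT₂ h₁ h₂ y) ∧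
    (∀ d ∈ graphSubalgebra hT₁ hT₂ h₁ h₂ y, adPair g₁⁻¹ g₂⁻¹ d ∈ graphSubalgebra hT₁ hT₂ h₁ h₂ y)}
  one_mem' := ⟨1, 1, G₁.one_mem, G₂.one_mem, by rw [← Prod.one_eq_mk, map_one],
    fun d hd => by rwa [adPair_one], fun d hd => by rwa [inv_one, inv_one, adPair_one]⟩
  mul_mem' := by
    rintro _ _ ⟨g₁, g₂, hg₁, hg₂, rfl, hs, hs'⟩ ⟨g₁', g₂', hg₁', hg₂', rfl, ht, ht'⟩
    refine ⟨g₁ * g₁', g₂ * g₂', G₁.mul_mem hg₁ hg₁', G₂.mul_mem hg₂ hg₂', by rw [← map_mul]; rfl,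
      fun d hd => ?_, fun d hd => ?_⟩
    · rw [adPair_mul]; exact hs _ (ht _ hd)
    · rw [mul_inv_rev, mul_inv_rev, adPair_mul]; exact ht' _ (hs' _ hd)
  inv_mem' := by
    rintro _ ⟨g₁, g₂, hg₁, hg₂, rfl, hs, hs'⟩
    refine ⟨g₁⁻¹, g₂⁻¹, G₁.inv_mem hg₁, G₂.inv_mem hg₂, by rw [← map_inv]; rfl, hs', fun d hd => ?_⟩
    rw [inv_inv, inv_inv]; exact hs _ hd

omit [CharZero k] [Fintype ι] in
/-- Membership of a block-diagonal element in `adStab`. [folklore] -/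
lemma blockDiagGL_mem_adStab_iff {y : Y} {g₁ : GL n₁ k} {g₂ : GL n₂ k} :
    blockDiagGL (g₁, g₂) ∈ adStab hT₁ hT₂ h₁ h₂ y ↔ g₁ ∈ G₁ ∧ g₂ ∈ G₂ ∧
      (∀ d ∈ graphSubalgebra hT₁ hT₂ h₁ h₂ y, adPair g₁ g₂ d ∈ graphSubalgebra hT₁ hT₂ h₁ h₂ y) ∧
      (∀ d ∈ graphSubalgebra hT₁ hT₂ h₁ h₂ y, adPair g₁⁻¹ g₂⁻¹ d ∈ graphSubalgebra hT₁ hT₂ h₁ h₂ y) := by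
  constructor
  · rintro ⟨g₁', g₂', hg₁, hg₂, he, hs, hs'⟩
    obtain ⟨rfl, rfl⟩ := Prod.ext_iff.1 (blockDiagGL_injective he)
    exact ⟨hg₁, hg₂, hs, hs'⟩
  · rintro ⟨hg₁, hg₂, hs, hs'⟩
    exact ⟨g₁, g₂, hg₁, hg₂, rfl, hs, hs'⟩

omit [CharZero k] [Fintype ι] in
/-- Elements of `adStab` are block diagonal with blocks in `G₁`, `G₂`. [folklore] -/
lemma exists_of_mem_adStab {y : Y} {g : GL (n₁ ⊕ n₂) k} (hg : g ∈ adStab hT₁ hT₂ h₁ h₂ y) :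
    ∃ g₁ : GL n₁ k, ∃ g₂ : GL n₂ k, g₁ ∈ G₁ ∧ g₂ ∈ G₂ ∧ blockDiagGL (g₁, g₂) = g ∧
      ∀ d ∈ graphSubalgebra hT₁ hT₂ h₁ h₂ y, adPair g₁ g₂ d ∈ graphSubalgebra hT₁ hT₂ h₁ h₂ y := by
  obtain ⟨g₁, g₂, hg₁, hg₂, he, hs, -⟩ := hg
  exact ⟨g₁, g₂, hg₁, hg₂, he, hs⟩

omit [CharZero k] [Fintype ι] in
/-- **`T̃ ≤ adStab`** (`σ_t` preserves `D`). [cite: SpringerLAG1998, 9.6.2] -/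
theorem graphTorus_le_adStab (y : Y) : graphTorus eX₁ eX₂ hT₁.2.1 hT₂.2.1 ≤ adStab hT₁ hT₂ h₁ h₂ y := by
  rintro _ ⟨t, rfl⟩
  rw [graphTorusHom_apply, blockDiagGL_mem_adStab_iff]
  refine ⟨hT₁.1 t.2, hT₂.1 (torusIsoOfWeights eX₁ eX₂ hT₁.2.1 hT₂.2.1 t).2, fun d hd => ?_, fun d hd => ?_⟩
  · have := sigma_mem_graphSubalgebra y t hd
    rw [sigma_apply] at this
    rw [adPair_apply]
    exact this
  · have e1 : ((t : ↥T₁) : GL n₁ k)⁻¹ = ((t⁻¹ : ↥T₁) : GL n₁ k) := rfl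
    have e2 : (((torusIsoOfWeights eX₁ eX₂ hT₁.2.1 hT₂.2.1 t : ↥T₂) : GL n₂ k))⁻¹ =
        ((torusIsoOfWeights eX₁ eX₂ hT₁.2.1 hT₂.2.1 t⁻¹ : ↥T₂) : GL n₂ k) := by rw [map_inv]; rfl
    rw [e1, e2, adPair_apply]
    have := sigma_mem_graphSubalgebra y t⁻¹ hd
    rw [sigma_apply] at this
    exact this

omit [IsMulCommutative ↥T₁] [IsMulCommutative ↥T₂] [IsAlgClosed k] [CharZero k] [Fintype ι] in
/-- A block of a nilpotent block-diagonal matrix is nilpotent (first block). [folklore] -/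
lemma isNilpotent_of_fromBlocks₁ {A : Matrix n₁ n₁ k} {B : Matrix n₂ n₂ k}
    (h : IsNilpotent (Matrix.fromBlocks A 0 0 B)) : IsNilpotent A := by
  obtain ⟨m, hm⟩ := h
  refine ⟨m, ?_⟩
  rw [fromBlocks_zero_pow] at hm
  have := congrArg Matrix.toBlocks₁₁ hm
  rw [Matrix.toBlocks_fromBlocks₁₁] at this
  rw [this]; rfl

omit [IsMulCommutative ↥T₁] [IsMulCommutative ↥T₂] [IsAlgClosed k] [CharZero k] [Fintype ι] in
/-- A block of a nilpotent block-diagonal matrix is nilpotent (second block). [folklore] -/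
lemma isNilpotent_of_fromBlocks₂ {A : Matrix n₁ n₁ k} {B : Matrix n₂ n₂ k}
    (h : IsNilpotent (Matrix.fromBlocks A 0 0 B)) : IsNilpotent B := by
  obtain ⟨m, hm⟩ := h
  refine ⟨m, ?_⟩
  rw [fromBlocks_zero_pow] at hm
  have := congrArg Matrix.toBlocks₂₂ hm
  rw [Matrix.toBlocks_fromBlocks₂₂] at this
  rw [this]; rfl

omit [Fintype ι] in
/-- `Ad (exp (c A)) × Ad (exp (c B))` preserves `D` when `(A, B) ∈ D` has nilpotent components: the
form used for the one-parameter groups. [cite: SpringerLAG1998, 4.4.15] -/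
theorem adPair_expHom_mem {y : Y} {A : Matrix n₁ n₁ k} {B : Matrix n₂ n₂ k}
    (hAB : ((A, B) : Matrix n₁ n₁ k × Matrix n₂ n₂ k) ∈ graphSubalgebra hT₁ hT₂ h₁ h₂ y)
    (hA : IsNilpotent A) (hB : IsNilpotent B) (x : Multiplicative k)
    {d : Matrix n₁ n₁ k × Matrix n₂ n₂ k} (hd : d ∈ graphSubalgebra hT₁ hT₂ h₁ h₂ y) :
    adPair (expHom A hA x) (expHom B hB x) d ∈ graphSubalgebra hT₁ hT₂ h₁ h₂ y := by
  have hN : ((x.toAdd • A, x.toAdd • B) : Matrix n₁ n₁ k × Matrix n₂ n₂ k) ∈ graphSubalgebra hT₁ hT₂ h₁ h₂ y := by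
    have := (graphSubalgebra hT₁ hT₂ h₁ h₂ y).smul_mem x.toAdd hAB
    rwa [Prod.smul_mk] at this
  have key := conj_exp_pair_mem (D := graphSubalgebra hT₁ hT₂ h₁ h₂ y) hN (hA.smul _) (hB.smul _) hd
  rw [adPair_apply, ← map_inv, ← map_inv, coe_expHom_apply, coe_expHom_apply, coe_expHom_apply, coe_expHom_apply,
    toAdd_inv, neg_smul, neg_smul]
  exact key

omit [Fintype ι] in
include hG₁ hG₂ in
/-- **`ũ_i(x) ∈ adStab` for simple `i`** (`Ad (exp x ẽ_i) D ⊆ D` since `ẽ_i = (e¹_i, e²_i) ∈ D`).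
[cite: SpringerLAG1998, 9.6.2 and 4.4.15] -/
theorem graphUpperGL_mem_adStab {y : Y} {i : ι} (hi : i ∈ simpleRoots P y) (x : Multiplicative k) :
    graphUpperGL h₁ h₂ i x ∈ adStab hT₁ hT₂ h₁ h₂ y := by
  haveI : Infinite k := IsAlgClosed.instInfinite
  have hn := isNilpotent_graphE h₁ h₂ hT₁.2.1 hT₂.2.1 i
  have hn1 : IsNilpotent (h₁.rootE i) := isNilpotent_of_fromBlocks₁ hn
  have hn2 : IsNilpotent (h₂.rootE i) := isNilpotent_of_fromBlocks₂ hn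
  obtain ⟨c, rfl⟩ : ∃ c : k, Multiplicative.ofAdd c = x := ⟨x.toAdd, rfl⟩
  rw [graphUpperGL_eq_expHom h₁ h₂ hT₁.2.1 hT₂.2.1 hG₁.1.1 hG₂.1.1 i,
    expHom_congr _ (isNilpotent_fromBlocks_zero hn1 hn2) (rfl : graphE h₁ h₂ i = Matrix.fromBlocks _ 0 0 _),
    expHom_fromBlocks hn1 hn2, blockDiagGL_mem_adStab_iff]
  refine ⟨expHom_mem_of_mem_lieAlgebraGL hG₁.1.1 (h₁.rootE_mem i).1 hn1 _,
    expHom_mem_of_mem_lieAlgebraGL hG₂.1.1 (h₂.rootE_mem i).1 hn2 _, fun d hd => ?_, fun d hd => ?_⟩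
  · exact adPair_expHom_mem hT₁ hT₂ h₁ h₂ (rootE_pair_mem hi) hn1 hn2 _ hd
  · rw [← (expHom _ hn1).map_inv, ← (expHom _ hn2).map_inv]
    exact adPair_expHom_mem hT₁ hT₂ h₁ h₂ (rootE_pair_mem hi) hn1 hn2 _ hd

omit [Fintype ι] in
include hG₁ hG₂ in
/-- **`ṽ_i(x) ∈ adStab` for simple `i`.** [cite: SpringerLAG1998, 9.6.2 and 4.4.15] -/
theorem graphLowerGL_mem_adStab {y : Y} {i : ι} (hi : i ∈ simpleRoots P y) (x : Multiplicative k) :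
    graphLowerGL h₁ h₂ i x ∈ adStab hT₁ hT₂ h₁ h₂ y := by
  haveI : Infinite k := IsAlgClosed.instInfinite
  have hn := isNilpotent_graphF h₁ h₂ hT₁.2.1 hT₂.2.1 i
  have hn1 : IsNilpotent (h₁.rootF i) := isNilpotent_of_fromBlocks₁ hn
  have hn2 : IsNilpotent (h₂.rootF i) := isNilpotent_of_fromBlocks₂ hn
  obtain ⟨c, rfl⟩ : ∃ c : k, Multiplicative.ofAdd c = x := ⟨x.toAdd, rfl⟩
  rw [graphLowerGL_eq_expHom h₁ h₂ hT₁.2.1 hT₂.2.1 hG₁.1.1 hG₂.1.1 i,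
    expHom_congr _ (isNilpotent_fromBlocks_zero hn1 hn2) (rfl : graphF h₁ h₂ i = Matrix.fromBlocks _ 0 0 _),
    expHom_fromBlocks hn1 hn2, blockDiagGL_mem_adStab_iff]
  refine ⟨expHom_mem_of_mem_lieAlgebraGL hG₁.1.1 (h₁.rootF_mem i).1 hn1 _,
    expHom_mem_of_mem_lieAlgebraGL hG₂.1.1 (h₂.rootF_mem i).1 hn2 _, fun d hd => ?_, fun d hd => ?_⟩
  · exact adPair_expHom_mem hT₁ hT₂ h₁ h₂ (rootF_pair_mem hi) hn1 hn2 _ hd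
  · rw [← (expHom _ hn1).map_inv, ← (expHom _ hn2).map_inv]
    exact adPair_expHom_mem hT₁ hT₂ h₁ h₂ (rootF_pair_mem hi) hn1 hn2 _ hd

omit [Fintype ι] in
include hG₁ hG₂ in
/-- **The graph group stabilises `D`**: `H ≤ adStab`. [cite: SpringerLAG1998, 9.6.2] -/
theorem graphGroup_le_adStab (y : Y) :
    graphGroup h₁ h₂ hT₁.2.1 hT₂.2.1 (simpleRoots P y) ≤ adStab hT₁ hT₂ h₁ h₂ y := by
  refine sup_le (graphTorus_le_adStab hT₁ hT₂ h₁ h₂ y) (iSup_le fun i => sup_le ?_ ?_)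
  · rintro _ ⟨x, rfl⟩; exact graphUpperGL_mem_adStab hG₁ hT₁ hG₂ hT₂ h₁ h₂ i.2 x
  · rintro _ ⟨x, rfl⟩; exact graphLowerGL_mem_adStab hG₁ hT₁ hG₂ hT₂ h₁ h₂ i.2 x

end Stab

/-! ### The kernel of the first projection lies in `T₂` -/

section Kernel

variable [IsAlgClosed k] [CharZero k] [Fintype ι]
variable (hG₁ : IsConnectedReductive G₁) (hT₁ : IsMaximalTorusIn T₁ G₁)
  (hG₂ : IsConnectedReductive G₂) (hT₂ : IsMaximalTorusIn T₂ G₂)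
  (h₁ : IsRootDatumOf G₁ T₁ P eX₁ eY₁) (h₂ : IsRootDatumOf G₂ T₂ P eX₂ eY₂)

include hG₁ hG₂ in
/-- **If `diag(1, z) ∈ adStab` then `z` commutes with `Lie(G₂)`** (`D` is a graph over `𝔤₁` with
`p₂(D) = 𝔤₂`). [cite: SpringerLAG1998, 9.6.2] -/
theorem commute_of_inrBlock_mem_adStab {y : Y} (hy : ∀ i, P.root' i y ≠ 0) {z : GL n₂ k}
    (hz : inrBlock z ∈ adStab hT₁ hT₂ h₁ h₂ y) {B : Matrix n₂ n₂ k} (hB : B ∈ lieAlgebraGL G₂) :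
    (z : Matrix n₂ n₂ k) * B = B * z := by
  rw [inrBlock_apply, blockDiagGL_mem_adStab_iff] at hz
  obtain ⟨-, -, hs, -⟩ := hz
  obtain ⟨d, hd, rfl⟩ := exists_mem_snd_eq hT₁ hG₂ hT₂ h₁ h₂ hy hB
  have hd' := hs d hd
  have heq := eq_of_fst_eq hG₁ hT₁ hG₂ hT₂ h₁ h₂ hy hd hd' (by simp [adPair_apply])
  have h2 := congrArg Prod.snd heq
  simp only [adPair_apply] at h2
  -- `d.2 = z d.2 z⁻¹`
  have := congrArg (fun M => M * (z : Matrix n₂ n₂ k)) h2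
  simp only [Matrix.mul_assoc] at this
  rw [Units.inv_mul, Matrix.mul_one] at this
  exact this.symm

include hG₁ hG₂ in
/-- **The kernel of the first projection of the graph group lies in the torus**: if
`diag(1, z) ∈ H` then `z ∈ T₂`. [cite: SpringerLAG1998, 9.6.2 and 7.6.4] -/
theorem mem_torus_of_inrBlock_mem_adStab {y : Y} (hy : ∀ i, P.root' i y ≠ 0) {z : GL n₂ k}
    (hz : inrBlock z ∈ adStab hT₁ hT₂ h₁ h₂ y) : z ∈ T₂ := by
  classical
  haveI : Infinite k := IsAlgClosed.instInfinite
  have hzG : z ∈ G₂ := by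
    have := hz; rw [inrBlock_apply, blockDiagGL_mem_adStab_iff] at this; exact this.2.1
  have hcomm := fun B hB => commute_of_inrBlock_mem_adStab hG₁ hT₁ hG₂ hT₂ h₁ h₂ hy hz (B := B) hB
  refine mem_torus_of_forall_commute_rootSL2 h₂ hG₂ hT₂ hzG (fun j x => ?_) (fun j x => ?_)
  · have hu := h₂.isRootHom_rootSL2_upper j
    have hv : hu.1.velocity = h₂.rootE j := h₂.velocity_rootSL2_upper j
    have hnil : IsNilpotent hu.1.velocity := by
      rw [hv]; exact isNilpotent_of_fromBlocks₂ (isNilpotent_graphE h₁ h₂ hT₁.2.1 hT₂.2.1 j)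
    refine Commute.units_of_val ?_
    have e := hu.coe_apply_eq_exp hG₂.1.1 hnil x
    rw [MonoidHom.comp_apply] at e
    rw [e, coe_expHom_apply, toAdd_ofAdd]
    refine commute_exp_of_commute ((Commute.smul_right ?_ x))
    rw [hv]; exact hcomm _ (h₂.rootE_mem j).1
  · have hu := h₂.isRootHom_rootSL2_lower j
    have hv : hu.1.velocity = h₂.rootF j := h₂.velocity_rootSL2_lower j
    have hnil : IsNilpotent hu.1.velocity := by
      rw [hv]; exact isNilpotent_of_fromBlocks₂ (isNilpotent_graphF h₁ h₂ hT₁.2.1 hT₂.2.1 j)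
    refine Commute.units_of_val ?_
    have e := hu.coe_apply_eq_exp hG₂.1.1 hnil x
    rw [MonoidHom.comp_apply] at e
    rw [e, coe_expHom_apply, toAdd_ofAdd]
    refine commute_exp_of_commute ((Commute.smul_right ?_ x))
    rw [hv]; exact hcomm _ (h₂.rootF_mem j).1

include hG₁ hG₂ in
/-- The same for the graph group itself. [cite: SpringerLAG1998, 9.6.2] -/
theorem mem_torus_of_inrBlock_mem_graphGroup {y : Y} (hy : ∀ i, P.root' i y ≠ 0) {z : GL n₂ k}
    (hz : inrBlock z ∈ graphGroup h₁ h₂ hT₁.2.1 hT₂.2.1 (simpleRoots P y)) : z ∈ T₂ :=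
  mem_torus_of_inrBlock_mem_adStab hG₁ hT₁ hG₂ hT₂ h₁ h₂ hy (graphGroup_le_adStab hG₁ hT₁ hG₂ hT₂ h₁ h₂ y hz)

include hG₁ hG₂ in
/-- Symmetrically: if `diag(z, 1) ∈ adStab` then `z` commutes with `Lie(G₁)`. [cite: SpringerLAG1998, 9.6.2] -/
theorem commute_of_inlBlock_mem_adStab {y : Y} (hy : ∀ i, P.root' i y ≠ 0) {z : GL n₁ k}
    (hz : inlBlock z ∈ adStab hT₁ hT₂ h₁ h₂ y) {A : Matrix n₁ n₁ k} (hA : A ∈ lieAlgebraGL G₁) :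
    (z : Matrix n₁ n₁ k) * A = A * z := by
  rw [inlBlock_apply, blockDiagGL_mem_adStab_iff] at hz
  obtain ⟨-, -, hs, -⟩ := hz
  obtain ⟨d, hd, rfl⟩ := exists_mem_fst_eq hG₁ hT₁ hT₂ h₁ h₂ hy hA
  have hd' := hs d hd
  have heq := eq_of_snd_eq hG₁ hT₁ hG₂ hT₂ h₁ h₂ hy hd hd' (by simp [adPair_apply])
  have h1 := congrArg Prod.fst heq
  simp only [adPair_apply] at h1
  have := congrArg (fun M => M * (z : Matrix n₁ n₁ k)) h1
  simp only [Matrix.mul_assoc] at this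
  rw [Units.inv_mul, Matrix.mul_one] at this
  exact this.symm

include hG₁ hG₂ in
/-- **If `diag(z, 1) ∈ H` then `z ∈ T₁`.** [cite: SpringerLAG1998, 9.6.2 and 7.6.4] -/
theorem mem_torus_of_inlBlock_mem_adStab {y : Y} (hy : ∀ i, P.root' i y ≠ 0) {z : GL n₁ k}
    (hz : inlBlock z ∈ adStab hT₁ hT₂ h₁ h₂ y) : z ∈ T₁ := by
  classical
  haveI : Infinite k := IsAlgClosed.instInfinite
  have hzG : z ∈ G₁ := by
    have := hz; rw [inlBlock_apply, blockDiagGL_mem_adStab_iff] at this; exact this.1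
  have hcomm := fun A hA => commute_of_inlBlock_mem_adStab hG₁ hT₁ hG₂ hT₂ h₁ h₂ hy hz (A := A) hA
  refine mem_torus_of_forall_commute_rootSL2 h₁ hG₁ hT₁ hzG (fun j x => ?_) (fun j x => ?_)
  · have hu := h₁.isRootHom_rootSL2_upper j
    have hv : hu.1.velocity = h₁.rootE j := h₁.velocity_rootSL2_upper j
    have hnil : IsNilpotent hu.1.velocity := by
      rw [hv]; exact isNilpotent_of_fromBlocks₁ (isNilpotent_graphE h₁ h₂ hT₁.2.1 hT₂.2.1 j)
    refine Commute.units_of_val ?_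
    have e := hu.coe_apply_eq_exp hG₁.1.1 hnil x
    rw [MonoidHom.comp_apply] at e
    rw [e, coe_expHom_apply, toAdd_ofAdd]
    refine commute_exp_of_commute ((Commute.smul_right ?_ x))
    rw [hv]; exact hcomm _ (h₁.rootE_mem j).1
  · have hu := h₁.isRootHom_rootSL2_lower j
    have hv : hu.1.velocity = h₁.rootF j := h₁.velocity_rootSL2_lower j
    have hnil : IsNilpotent hu.1.velocity := by
      rw [hv]; exact isNilpotent_of_fromBlocks₁ (isNilpotent_graphF h₁ h₂ hT₁.2.1 hT₂.2.1 j)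
    refine Commute.units_of_val ?_
    have e := hu.coe_apply_eq_exp hG₁.1.1 hnil x
    rw [MonoidHom.comp_apply] at e
    rw [e, coe_expHom_apply, toAdd_ofAdd]
    refine commute_exp_of_commute ((Commute.smul_right ?_ x))
    rw [hv]; exact hcomm _ (h₁.rootF_mem j).1

include hG₁ hG₂ in
/-- The same for the graph group itself. [cite: SpringerLAG1998, 9.6.2] -/
theorem mem_torus_of_inlBlock_mem_graphGroup {y : Y} (hy : ∀ i, P.root' i y ≠ 0) {z : GL n₁ k}
    (hz : inlBlock z ∈ graphGroup h₁ h₂ hT₁.2.1 hT₂.2.1 (simpleRoots P y)) : z ∈ T₁ :=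
  mem_torus_of_inlBlock_mem_adStab hG₁ hT₁ hG₂ hT₂ h₁ h₂ hy (graphGroup_le_adStab hG₁ hT₁ hG₂ hT₂ h₁ h₂ y hz)

end Kernel

/-! ### The projections of the graph group are surjective -/

section Projections

variable [IsAlgClosed k] [CharZero k] [Fintype ι]
variable (hG₁ : IsConnectedReductive G₁) (hT₁ : IsMaximalTorusIn T₁ G₁)
  (hG₂ : IsConnectedReductive G₂) (hT₂ : IsMaximalTorusIn T₂ G₂)
  (h₁ : IsRootDatumOf G₁ T₁ P eX₁ eY₁) (h₂ : IsRootDatumOf G₂ T₂ P eX₂ eY₂)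

omit [CharZero k] [Fintype ι] in
/-- The first projection `F₁` of the graph group lies in `G₁`. [folklore] -/
theorem fstOfGraphGroup_le (S : Set ι) : fstOfGraphGroup h₁ h₂ hT₁.2.1 hT₂.2.1 S ≤ G₁ := by
  intro g hg
  obtain ⟨x, hx, rfl⟩ := (mem_fstOfGraphGroup_iff h₁ h₂ hT₁.2.1 hT₂.2.1 S).1 hg
  have hx' := graphGroup_le_prodBlock h₁ h₂ hT₁.2.1 hT₂.2.1 S hx
  exact (fstBlockGL_mem_of_mem_prodBlock hx').1

omit [CharZero k] [Fintype ι] in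
/-- `F₁` is the range of the algebraic homomorphism `fstBlockGL ∘ (H ↪ blockDiagRange)`. [folklore] -/
lemma fstOfGraphGroup_eq_range (S : Set ι) :
    fstOfGraphGroup h₁ h₂ hT₁.2.1 hT₂.2.1 S =
      (fstBlockGL.comp (Subgroup.inclusion (graphGroup_le_blockDiagRange h₁ h₂ hT₁.2.1 hT₂.2.1 S))).range := by
  ext g
  rw [mem_fstOfGraphGroup_iff, MonoidHom.mem_range]
  constructor
  · rintro ⟨x, hx, rfl⟩; exact ⟨⟨x, hx⟩, rfl⟩
  · rintro ⟨x, rfl⟩; exact ⟨⟨x, graphGroup_le_blockDiagRange h₁ h₂ hT₁.2.1 hT₂.2.1 S x.2⟩, x.2, rfl⟩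

omit [CharZero k] [Fintype ι] in
/-- `F₁` is Zariski-connected. [cite: SpringerLAG1998, 2.2.5 (ii)] -/
theorem isZConnected_fstOfGraphGroup (S : Set ι) : IsZConnected (fstOfGraphGroup h₁ h₂ hT₁.2.1 hT₂.2.1 S) := by
  rw [fstOfGraphGroup_eq_range hT₁ hT₂ h₁ h₂ S]
  exact (isAlgebraicGL_fstBlockGL_comp _).isZConnected_range (isZConnected_graphGroup h₁ h₂ hT₁.2.1 hT₂.2.1 S)

include hG₁ in
/-- **The first projection of the graph group is all of `G₁`** (Lie algebras: `Lie(F₁)` contains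
`Lie(T₁)` and the simple `e¹_i, f¹_i`, hence `Lie(G₁)` by the generation theorem of
`RootStrings.lean`, and `F₁` is closed connected). [cite: SpringerLAG1998, 9.6.2] -/
theorem fstOfGraphGroup_eq {y : Y} (hy : ∀ i, P.root' i y ≠ 0) :
    fstOfGraphGroup h₁ h₂ hT₁.2.1 hT₂.2.1 (simpleRoots P y) = G₁ := by
  haveI : Infinite k := IsAlgClosed.instInfinite
  set F := fstOfGraphGroup h₁ h₂ hT₁.2.1 hT₂.2.1 (simpleRoots P y) with hF
  have hFG : F ≤ G₁ := fstOfGraphGroup_le hT₁ hT₂ h₁ h₂ _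
  have hFc : IsZConnected F := isZConnected_fstOfGraphGroup hT₁ hT₂ h₁ h₂ _
  -- root vectors of simple roots lie in `Lie(F)`
  have hE : ∀ i ∈ simpleRoots P y, h₁.rootE i ∈ lieAlgebraGL F := by
    intro i hi
    rw [← h₁.velocity_rootSL2_upper i]
    exact (h₁.isRootHom_rootSL2_upper i).1.velocity_mem_lieAlgebraGL
      (range_upper_le_fstOfGraphGroup h₁ h₂ hT₁.2.1 hT₂.2.1 (simpleRoots P y) hi)
  have hFr : ∀ i ∈ simpleRoots P y, h₁.rootF i ∈ lieAlgebraGL F := by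
    intro i hi
    rw [← h₁.velocity_rootSL2_lower i]
    exact (h₁.isRootHom_rootSL2_lower i).1.velocity_mem_lieAlgebraGL
      (range_lower_le_fstOfGraphGroup h₁ h₂ hT₁.2.1 hT₂.2.1 (simpleRoots P y) hi)
  have hL : ∀ A ∈ lieAlgebraGL F, ∀ B ∈ lieAlgebraGL F, A * B - B * A ∈ lieAlgebraGL F :=
    fun A hA B hB => lie_mem_lieAlgebraGL hA hB
  have hall : ∀ γ, h₁.rootE γ ∈ lieAlgebraGL F :=
    fun γ => h₁.rootE_mem_of_forall_simpleRoots hG₁ hT₁ hy hL hE hFr γ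
  -- hence `Lie(G₁) ≤ Lie(F)`
  have hle : lieAlgebraGL G₁ ≤ lieAlgebraGL F := by
    refine (lieAlgebraGL_le_torus_sup_roots h₁ hG₁ hT₁ (eX₁ := eX₁)).trans (sup_le ?_ (iSup_le fun γ => ?_))
    · exact lieAlgebraGL_mono (torus_le_fstOfGraphGroup h₁ h₂ hT₁.2.1 hT₂.2.1 _)
    · intro B hB
      obtain ⟨c, rfl⟩ := (h₁.mem_lieWeightSpace_root_iff hG₁ hT₁ γ).1 hB
      exact Submodule.smul_mem _ c (hall γ)
  exact hFc.eq_of_le_of_lieAlgebraGL_eq hG₁.1 hFG (le_antisymm (lieAlgebraGL_mono hFG) hle)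

include hG₁ in
/-- Unpacked: every `g₁ ∈ G₁` is the first block of an element of the graph group.
[cite: SpringerLAG1998, 9.6.2] -/
theorem exists_blockDiagGL_mem_graphGroup {y : Y} (hy : ∀ i, P.root' i y ≠ 0) {g₁ : GL n₁ k} (hg₁ : g₁ ∈ G₁) :
    ∃ g₂ ∈ G₂, blockDiagGL (g₁, g₂) ∈ graphGroup h₁ h₂ hT₁.2.1 hT₂.2.1 (simpleRoots P y) := by
  rw [← fstOfGraphGroup_eq hG₁ hT₁ hT₂ h₁ h₂ hy, mem_fstOfGraphGroup_iff] at hg₁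
  obtain ⟨x, hx, rfl⟩ := hg₁
  have hx' := graphGroup_le_prodBlock h₁ h₂ hT₁.2.1 hT₂.2.1 _ hx
  obtain ⟨g, hg, g', hg', hgg⟩ := mem_prodBlock_iff.1 hx'
  refine ⟨g', hg', ?_⟩
  have : fstBlockGL x = g := by
    rw [show x = ⟨blockDiagGL (g, g'), blockDiagGL_mem_blockDiagRange _⟩ from Subtype.ext hgg.symm, fstBlockGL_mk]
  rw [this, hgg]
  exact hx

omit [CharZero k] [Fintype ι] in
/-- The second projection `F₂` of the graph group lies in `G₂`. [folklore] -/
theorem sndOfGraphGroup_le (S : Set ι) : sndOfGraphGroup h₁ h₂ hT₁.2.1 hT₂.2.1 S ≤ G₂ := by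
  intro g hg
  obtain ⟨x, hx, rfl⟩ := (mem_sndOfGraphGroup_iff h₁ h₂ hT₁.2.1 hT₂.2.1 S).1 hg
  have hx' := graphGroup_le_prodBlock h₁ h₂ hT₁.2.1 hT₂.2.1 S hx
  exact (fstBlockGL_mem_of_mem_prodBlock hx').2

omit [CharZero k] [Fintype ι] in
/-- `F₂` is a range. [folklore] -/
lemma sndOfGraphGroup_eq_range (S : Set ι) :
    sndOfGraphGroup h₁ h₂ hT₁.2.1 hT₂.2.1 S =
      (sndBlockGL.comp (Subgroup.inclusion (graphGroup_le_blockDiagRange h₁ h₂ hT₁.2.1 hT₂.2.1 S))).range := by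
  ext g
  rw [mem_sndOfGraphGroup_iff, MonoidHom.mem_range]
  constructor
  · rintro ⟨x, hx, rfl⟩; exact ⟨⟨x, hx⟩, rfl⟩
  · rintro ⟨x, rfl⟩; exact ⟨⟨x, graphGroup_le_blockDiagRange h₁ h₂ hT₁.2.1 hT₂.2.1 S x.2⟩, x.2, rfl⟩

omit [CharZero k] [Fintype ι] in
/-- `F₂` is Zariski-connected. [cite: SpringerLAG1998, 2.2.5 (ii)] -/
theorem isZConnected_sndOfGraphGroup (S : Set ι) : IsZConnected (sndOfGraphGroup h₁ h₂ hT₁.2.1 hT₂.2.1 S) := by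
  rw [sndOfGraphGroup_eq_range hT₁ hT₂ h₁ h₂ S]
  exact (isAlgebraicGL_sndBlockGL_comp _).isZConnected_range (isZConnected_graphGroup h₁ h₂ hT₁.2.1 hT₂.2.1 S)

include hG₂ in
/-- **The second projection of the graph group is all of `G₂`.** [cite: SpringerLAG1998, 9.6.2] -/
theorem sndOfGraphGroup_eq {y : Y} (hy : ∀ i, P.root' i y ≠ 0) :
    sndOfGraphGroup h₁ h₂ hT₁.2.1 hT₂.2.1 (simpleRoots P y) = G₂ := by
  haveI : Infinite k := IsAlgClosed.instInfinite
  set F := sndOfGraphGroup h₁ h₂ hT₁.2.1 hT₂.2.1 (simpleRoots P y) with hF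
  have hFG : F ≤ G₂ := sndOfGraphGroup_le hT₁ hT₂ h₁ h₂ _
  have hFc : IsZConnected F := isZConnected_sndOfGraphGroup hT₁ hT₂ h₁ h₂ _
  have hE : ∀ i ∈ simpleRoots P y, h₂.rootE i ∈ lieAlgebraGL F := by
    intro i hi
    rw [← h₂.velocity_rootSL2_upper i]
    exact (h₂.isRootHom_rootSL2_upper i).1.velocity_mem_lieAlgebraGL
      (range_upper_le_sndOfGraphGroup h₁ h₂ hT₁.2.1 hT₂.2.1 (simpleRoots P y) hi)
  have hFr : ∀ i ∈ simpleRoots P y, h₂.rootF i ∈ lieAlgebraGL F := by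
    intro i hi
    rw [← h₂.velocity_rootSL2_lower i]
    exact (h₂.isRootHom_rootSL2_lower i).1.velocity_mem_lieAlgebraGL
      (range_lower_le_sndOfGraphGroup h₁ h₂ hT₁.2.1 hT₂.2.1 (simpleRoots P y) hi)
  have hL : ∀ A ∈ lieAlgebraGL F, ∀ B ∈ lieAlgebraGL F, A * B - B * A ∈ lieAlgebraGL F :=
    fun A hA B hB => lie_mem_lieAlgebraGL hA hB
  have hall : ∀ γ, h₂.rootE γ ∈ lieAlgebraGL F :=
    fun γ => h₂.rootE_mem_of_forall_simpleRoots hG₂ hT₂ hy hL hE hFr γ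
  have hle : lieAlgebraGL G₂ ≤ lieAlgebraGL F := by
    refine (lieAlgebraGL_le_torus_sup_roots h₂ hG₂ hT₂ (eX₁ := eX₂)).trans (sup_le ?_ (iSup_le fun γ => ?_))
    · exact lieAlgebraGL_mono (torus_le_sndOfGraphGroup h₁ h₂ hT₁.2.1 hT₂.2.1 _)
    · intro B hB
      obtain ⟨c, rfl⟩ := (h₂.mem_lieWeightSpace_root_iff hG₂ hT₂ γ).1 hB
      exact Submodule.smul_mem _ c (hall γ)
  exact hFc.eq_of_le_of_lieAlgebraGL_eq hG₂.1 hFG (le_antisymm (lieAlgebraGL_mono hFG) hle)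

include hG₂ in
/-- Unpacked: every `g₂ ∈ G₂` is the second block of an element of the graph group.
[cite: SpringerLAG1998, 9.6.2] -/
theorem exists_blockDiagGL_mem_graphGroup' {y : Y} (hy : ∀ i, P.root' i y ≠ 0) {g₂ : GL n₂ k} (hg₂ : g₂ ∈ G₂) :
    ∃ g₁ ∈ G₁, blockDiagGL (g₁, g₂) ∈ graphGroup h₁ h₂ hT₁.2.1 hT₂.2.1 (simpleRoots P y) := by
  rw [← sndOfGraphGroup_eq hT₁ hG₂ hT₂ h₁ h₂ hy, mem_sndOfGraphGroup_iff] at hg₂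
  obtain ⟨x, hx, rfl⟩ := hg₂
  have hx' := graphGroup_le_prodBlock h₁ h₂ hT₁.2.1 hT₂.2.1 _ hx
  obtain ⟨g, hg, g', hg', hgg⟩ := mem_prodBlock_iff.1 hx'
  refine ⟨g, hg, ?_⟩
  have : sndBlockGL x = g' := by
    rw [show x = ⟨blockDiagGL (g, g'), blockDiagGL_mem_blockDiagRange _⟩ from Subtype.ext hgg.symm, sndBlockGL_mk]
  rw [this, hgg]
  exact hx

end Projections

end LieGraph

end Literature.NumberTheory.Automorphic
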